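import Literature.MathematicalPhysics.QuantumLattice.HeisenbergRPCorrelationBlocks
import Literature.MathematicalPhysics.QuantumLattice.HeisenbergOrderNeelShortRange
import HarnessLib

/-!
# The two-spin triplet bound on the ground-state correlation function of the torus antiferromagnet

For two spins ½ at distinct sites the exchange operator satisfies `𝐒_x·𝐒_y ≤ ¼` (its spectrum is
`{-¾, ¼}`; in the tree as `posSemidef_quarter_sub_spinDot_one`, Tasaki 2020 §2.4 / App. A.3).
In the tracial ground state `ω₀` of the spin-½ Heisenberg antiferromagnet on the torus `(ℤ/Lℤ)²`
this gives `⟨𝐒_0·𝐒_r⟩₀ ≤ ¼`, i.e. by isotropy (`⟨𝐒_0·𝐒_r⟩₀ = 3 c(r)`,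
`groundStateSpinCorrTorus_one_eq_three_mul`) the TRIPLET BOUND `c(r) ≤ 1/12` (`r ≠ 0`) on the reduced
correlation function `c(a,b) = ⟨Sˣ_0 Sˣ_(a,b)⟩₀` (`heisRedCorr2 L 1 a b`), complementing the in-tree
`|c| ≤ ¼` (`heisRedCorr2_abs_le`) and the Marshall–Lieb–Mattis sign of the odd sublattice
(`groundStateSpinCorrTorus_nonpos_of_parity_ne`). It is one of the (T) inputs of the finite-volume
linear programmes over `c(a,b)` (HubbardLadder R2 rows). [cite: Tasaki2020, §2.4]
-/

noncomputable section

open Matrix Finset Literature.Probability.LatticeModels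
open Literature.MathematicalPhysics.QuantumLattice Literature.MathematicalPhysics.QuantumLattice.SpinOperators

namespace Literature.MathematicalPhysics.QuantumLattice

/-- **The triplet bound in the ground state**: `⟨𝐒_0·𝐒_r⟩₀ ≤ ¼` for `r ≠ 0` on the torus
`(ℤ/Lℤ)^d` (spin ½, `J = 1`). [cite: Tasaki2020, §2.4] -/
theorem groundStateSpinCorrTorus_one_le_quarter {d : ℕ} (L : ℕ) [NeZero L] {x y : TorusSite d L}
    (h : x ≠ y) : groundStateSpinCorrTorus L 1 1 x y ≤ 1 / 4 := by
  have hH := heisenbergTorus_isHermitian d L 1 1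
  have h1 : groundStateSpinCorrTorus L 1 1 x y =
      ((heisenbergTorus d L 1 1).groundStateFunctional (spinDot 1 x y)).re := by
    rw [groundStateSpinCorrTorus_of_neZero, ← map_sum, ← spinDot_eq_sum_mul_of_ne 1 h]
  have hpsd := groundStateFunctional_nonneg_of_posSemidef (heisenbergTorus d L 1 1)
    (posSemidef_quarter_sub_spinDot_one h)
  rw [map_sub, map_smul, groundStateFunctional_one hH, smul_eq_mul, mul_one] at hpsd
  have hre := (Complex.le_def.mp hpsd).1
  simp only [Complex.zero_re, Complex.sub_re] at hre
  norm_num at hre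
  linarith

/-- **The triplet bound on the reduced correlation function** of the square torus:
`c(a,b) ≤ 1/12` for `(a,b) ≠ 0` (`⟨𝐒_0·𝐒_r⟩₀ = 3c(r) ≤ ¼`). [cite: Tasaki2020, §2.4] -/
theorem heisRedCorr2_le_one_div_twelve (L : ℕ) [NeZero L] (a b : ℕ)
    (h : (0 : TorusSite 2 L) ≠ ![(a : ZMod L), (b : ZMod L)]) :
    heisRedCorr2 L 1 a b ≤ 1 / 12 := by
  have h3 : 3 * heisRedCorr2 L 1 a b =
      groundStateSpinCorrTorus L 1 1 0 ![(a : ZMod L), (b : ZMod L)] := by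
    rw [groundStateSpinCorrTorus_one_eq_three_mul, heisRedCorr2]
  have hq := groundStateSpinCorrTorus_one_le_quarter L h
  linarith

end Literature.MathematicalPhysics.QuantumLattice
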